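import Mathlib.LinearAlgebra.Matrix.GeneralLinearGroup.Defs
import Mathlib.LinearAlgebra.Matrix.Determinant.Basic
import Mathlib.GroupTheory.OrderOfElement
import Literature.IUT.HodgeTheaters.Labels
import HarnessLib

/-!
# The Borel and "semi-unipotent up to `±1`" subgroups of `GL₂(F_l)` and the quotient `F_l^⋇`
# ([IUTchI] Example 4.3 (i)) — abc-iut cell, layer L5

Mochizuki, *Inter-universal Teichmüller theory I*, §4 (kurims May-2020 manuscript), Example 4.3 (i) pp. 98–99: with
respect to a suitable basis of the `l`-torsion `Δ_X^{ab} ⊗ F_l`, "the images of the groups `Aut_ε(C_K)`, `Aut(C_K)` may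
be identified with the subgroups consisting of elements of the form `{(* *; 0 ±1)} ⊆ {(* *; 0 *)}` — i.e.,
"semi-unipotent, up to `±1`" and "Borel" subgroups"; "one verifies immediately that the subgroup `Aut_ε(C_K) ⊆
Aut(C_K)` is normal, and that we have natural isomorphisms … `Aut(C_K)/Aut_ε(C_K) ⥲ F_l^⋇`".

This file PROVES the matrix-group content of that sentence, inside `GL₂(F_l)` (passing to `GL₂(F_l)/{±1}` changes
nothing, since `-1` lies in the semi-unipotent subgroup — `neg_one_mem_semiUnipPM`): the Borel subgroup `borel l`
of upper-triangular elements; the homomorphism "lower-right entry modulo `±1`" `borelLabel : borel l →* F_l^⋇`; its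
kernel `semiUnipPM l` = the matrices `(* *; 0 ±1)` (`mem_semiUnipPM_iff`), which is therefore NORMAL in the Borel
(`semiUnipPM_normal`); surjectivity and the isomorphism `borel l ⧸ semiUnipPM l ≃* F_l^⋇` (`borelQuotientEquiv`).
The identification of `Aut(C_K)` with the Borel subgroup of `Im(G_{F_mod})` itself needs the Galois representation on
`E_F[l]` of Def. 3.1 (c) and [AbsTopIII] Thm. 1.9 (layers L4/L5-t2) and is not asserted here.
Record-only; [claim: Mochizuki2012, status: disputed]; nothing here takes a side.
-/

namespace Literature.IUT.HodgeTheaters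

open Matrix

namespace BorelLabels

variable (l : ℕ) [Fact l.Prime]

/-- `GL₂(F_l)`. [claim: Mochizuki2012, status: disputed] -/
abbrev GL2 : Type := GL (Fin 2) (ZMod l)

variable {l} in
/-- The `(i,j)` entry of an element of `GL₂(F_l)`. [claim: Mochizuki2012, status: disputed] -/
abbrev entry (g : GL2 l) (i j : Fin 2) : ZMod l := (g : Matrix (Fin 2) (Fin 2) (ZMod l)) i j

variable {l} in
/-- Matrix multiplication, lower-left entry. [claim: Mochizuki2012, status: disputed] -/
theorem entry_mul_10 (g h : GL2 l) : entry (g * h) 1 0 = entry g 1 0 * entry h 0 0 + entry g 1 1 * entry h 1 0 := by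
  simp [entry, Matrix.mul_apply, Fin.sum_univ_two]

variable {l} in
/-- Matrix multiplication, lower-right entry. [claim: Mochizuki2012, status: disputed] -/
theorem entry_mul_11 (g h : GL2 l) : entry (g * h) 1 1 = entry g 1 0 * entry h 0 1 + entry g 1 1 * entry h 1 1 := by
  simp [entry, Matrix.mul_apply, Fin.sum_univ_two]

/-- **Example 4.3 (i)**: the "Borel" subgroup `{(* *; 0 *)} ⊆ GL₂(F_l)` of upper-triangular elements.
[claim: Mochizuki2012, status: disputed] -/
def borel : Subgroup (GL2 l) where
  carrier := {g | entry g 1 0 = 0}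
  one_mem' := by simp [entry]
  mul_mem' {g h} hg hh := by
    simp only [Set.mem_setOf_eq] at hg hh ⊢
    rw [entry_mul_10, hg, hh, mul_zero, zero_mul, add_zero]
  inv_mem' {g} hg := by
    -- in a finite group `g⁻¹` is a power of `g`, and the carrier is multiplicatively closed
    have hpow : ∀ n : ℕ, entry (g ^ n) 1 0 = 0 := by
      intro n
      induction n with
      | zero => simp [entry]
      | succ n ih => rw [pow_succ, entry_mul_10, ih, hg, mul_zero, zero_mul, add_zero]
    have h : g⁻¹ = g ^ (orderOf g - 1) := by
      rw [eq_comm, ← mul_eq_one_iff_eq_inv, ← pow_succ, Nat.sub_add_cancel (orderOf_pos g), pow_orderOf_eq_one]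
    simp only [Set.mem_setOf_eq, h]
    exact hpow _

variable {l} in
/-- Membership in the Borel subgroup. [claim: Mochizuki2012, status: disputed] -/
theorem mem_borel_iff (g : GL2 l) : g ∈ borel l ↔ entry g 1 0 = 0 := Iff.rfl

variable {l} in
/-- For an upper-triangular invertible matrix the lower-right entry is a unit (`det = a·d`).
[claim: Mochizuki2012, status: disputed] -/
theorem isUnit_entry_11 (g : borel l) : IsUnit (entry (g : GL2 l) 1 1) := by
  have hdet : IsUnit ((g : GL2 l) : Matrix (Fin 2) (Fin 2) (ZMod l)).det :=
    ⟨Matrix.GeneralLinearGroup.det (g : GL2 l), rfl⟩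
  rw [Matrix.det_fin_two] at hdet
  have h10 : entry (g : GL2 l) 1 0 = 0 := g.2
  change IsUnit (entry (g : GL2 l) 0 0 * entry (g : GL2 l) 1 1 - entry (g : GL2 l) 0 1 * entry (g : GL2 l) 1 0) at hdet
  rw [h10, mul_zero, sub_zero] at hdet
  exact isUnit_of_mul_isUnit_right hdet

/-- **Example 4.3 (i)**: the homomorphism "lower-right entry, modulo `±1`" from the Borel subgroup to
`F_l^⋇ = F_lˣ/{±1}` (the quotient map `Aut(C_K) → Aut(C_K)/Aut_ε(C_K) ⥲ F_l^⋇` in matrix form).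
[claim: Mochizuki2012, status: disputed] -/
noncomputable def borelLabel : borel l →* FlStar l where
  toFun g := FlStar.mk l (isUnit_entry_11 g).unit
  map_one' := by
    have : (isUnit_entry_11 (1 : borel l)).unit = 1 := Units.ext (by simp [entry])
    rw [this]; rfl
  map_mul' g h := by
    have hmul : (isUnit_entry_11 (g * h)).unit = (isUnit_entry_11 g).unit * (isUnit_entry_11 h).unit := by
      apply Units.ext
      simp only [IsUnit.unit_spec, Units.val_mul]
      change entry ((g : GL2 l) * (h : GL2 l)) 1 1 = _
      rw [entry_mul_11, show entry (g : GL2 l) 1 0 = 0 from g.2, zero_mul, zero_add]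
    rw [hmul]; rfl

/-- **Example 4.3 (i)**: the "semi-unipotent up to `±1`" subgroup — defined as the kernel of `borelLabel` and
identified below with `{(* *; 0 ±1)}`. [claim: Mochizuki2012, status: disputed] -/
noncomputable def semiUnipPM : Subgroup (borel l) := (borelLabel l).ker

variable {l} in
/-- **Example 4.3 (i)**: the kernel consists exactly of the matrices `(* *; 0 ±1)`. [claim: Mochizuki2012, status: disputed] -/
theorem mem_semiUnipPM_iff (g : borel l) :
    g ∈ semiUnipPM l ↔ entry (g : GL2 l) 1 1 = 1 ∨ entry (g : GL2 l) 1 1 = -1 := by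
  rw [semiUnipPM, MonoidHom.mem_ker]
  change FlStar.mk l (isUnit_entry_11 g).unit = ((1 : (ZMod l)ˣ) : FlStar l) ↔ _
  rw [FlStar.mk, QuotientGroup.eq, mem_unitsPlusMinus_iff]
  simp only [mul_one, inv_eq_iff_eq_inv]
  rw [Units.ext_iff, Units.ext_iff, IsUnit.unit_spec]
  simp

/-- Ex. 4.3 (i): "one verifies immediately that the subgroup `Aut_ε(C_K) ⊆ Aut(C_K)` is normal" — in matrix form,
`{(* *; 0 ±1)}` is normal in the Borel. [claim: Mochizuki2012, status: disputed] -/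
instance semiUnipPM_normal : (semiUnipPM l).Normal := by
  unfold semiUnipPM; infer_instance

/-- The diagonal element `diag(1, u)` of the Borel subgroup. [claim: Mochizuki2012, status: disputed] -/
def diag (u : (ZMod l)ˣ) : borel l :=
  ⟨Matrix.GeneralLinearGroup.mkOfDetNeZero !![1, 0; 0, (u : ZMod l)]
      (by rw [Matrix.det_fin_two]; simp [u.ne_zero]),
    by simp [mem_borel_iff, entry, Matrix.GeneralLinearGroup.mkOfDetNeZero, Matrix.GeneralLinearGroup.mk',
      Matrix.unitOfDetInvertible]⟩

/-- The label of `diag(1, u)` is the class of `u`. [claim: Mochizuki2012, status: disputed] -/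
theorem borelLabel_diag (u : (ZMod l)ˣ) : borelLabel l (diag l u) = FlStar.mk l u := by
  have : (isUnit_entry_11 (diag l u)).unit = u := Units.ext (by
    rw [IsUnit.unit_spec]
    simp [diag, entry, Matrix.GeneralLinearGroup.mkOfDetNeZero, Matrix.GeneralLinearGroup.mk',
      Matrix.unitOfDetInvertible])
  change FlStar.mk l (isUnit_entry_11 (diag l u)).unit = _
  rw [this]

/-- Ex. 4.3 (i): the label homomorphism is surjective. [claim: Mochizuki2012, status: disputed] -/
theorem borelLabel_surjective : Function.Surjective (borelLabel l) := by
  intro j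
  induction j using QuotientGroup.induction_on with
  | H u => exact ⟨diag l u, borelLabel_diag l u⟩

/-- **Example 4.3 (i)**: "natural isomorphisms … `Aut(C_K)/Aut_ε(C_K) ⥲ F_l^⋇`" — in matrix form, the Borel modulo the
semi-unipotent-up-to-`±1` subgroup is `F_l^⋇`. [claim: Mochizuki2012, status: disputed] -/
noncomputable def borelQuotientEquiv : borel l ⧸ semiUnipPM l ≃* FlStar l :=
  QuotientGroup.quotientKerEquivOfSurjective _ (borelLabel_surjective l)

/-- `-1 ∈ GL₂(F_l)` lies in the semi-unipotent-up-to-`±1` subgroup, so the statements are unchanged in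
`GL₂(F_l)/{±1}` (the form in which Ex. 4.3 (i) states them). [claim: Mochizuki2012, status: disputed] -/
theorem neg_one_mem_semiUnipPM :
    ∃ h : (-1 : GL2 l) ∈ borel l, (⟨-1, h⟩ : borel l) ∈ semiUnipPM l := by
  refine ⟨by simp [mem_borel_iff, entry], ?_⟩
  rw [mem_semiUnipPM_iff]
  right
  simp [entry]

end BorelLabels

end Literature.IUT.HodgeTheaters
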